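/-
Copyright (c) 2026 the pub-hodgecm-mathlib formalisation cell (harness21).  Prover seat hodgecm-mathlib-K2E1-p13 (g2), Track B ∕ K2-LIT, h413 = `stmt-HodgeConjecture-24833`,
line `K2_E1_TraceFormulaBeta`, ROADCARD «5Res ENDGAME BY FAMILIES» C3 FILE 2 (dealer K2E1-plan (g7) (219)): the GLOBAL functional equation `c(z; χ)·c(1 − z; χʷ) = 1` of the rank-one
`(χ,τ)` scattering scalars of `U(1,1)_{L∕L⁺}` — the CM ASSEMBLY of ★ FILE 1 on two ★ X1_χ §2c ball packages (binders in their exact clause shapes) and the ★ X2_χ global coefficient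
pieces (binders), through ★ FILE 0's identification and globalisation lemmas.
-/
import Summits.HodgeConjecture.HodgeConjecture.Theorems.K2E1ChiScatteringFunctionalEquationCMTwo     -- ★ FILE 1 p860048 (this seat): `coeff_mul_coeff_apply_eq_of_packages`; brings ★ FILE 0 (ED. 2) and ★ (G1)
import Summits.HodgeConjecture.HodgeConjecture.Theorems.K2E1ChiEisensteinBallPackageCMTwoScalar     -- ★ X1_χ §2c p860051 (K2E1-p14): the per-ball package whose conclusion clauses are this file's binders (currency only)
import Summits.HodgeConjecture.HodgeConjecture.Theorems.K2E1BLXSystemPackageFinDimU                -- ★ 11b: `sum_proj_smulRight_apply` (the coordinate family `(ι′ → ℂ) →L HN`)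
import HarnessLib

/-!
# C3 FILE 2 — `K2E1ChiScatteringFunctionalEquationCMTwoGlobal`: THE GLOBAL FUNCTIONAL EQUATION `c(z; χ)·c(1 − z; χʷ) = 1` OF THE RANK-ONE `(χ,τ)` SCATTERING SCALARS OF `U(1,1)_{L∕L⁺}`

Track B ∕ K2-LIT, crux h413 = `stmt-HodgeConjecture-24833`, route of record `HCCMUnconditional`; cell `hodgecm-mathlib`, squad K2, ENGINE E1.  THEOREMS ONLY (no `def`, no `instance`,
no `notation`, no `sorry`; default heartbeats); lane `--supports stmt-HodgeConjecture-24833 --as helper` (count-neutral).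

THE MATHEMATICS ([BernsteinLapid2019, §4 Claims 2–5, §5]; [MoeglinWaldspurger1995, IV.1.8–IV.1.10]; [Langlands1976, §7]).  INPUT, all as BINDERS in the exact clause shapes of the ★ suppliers
(level `K_max`, `dim V(χ) = dim V(χʷ) = 1`: `κ` a singleton; the column space `ι′ → ℂ` with the dual datum `φ′_{j₀}`):
(i) the χ-BALL PACKAGE of ★ X1_χ §2c `K2E1ChiEisensteinBallPackageCMTwoScalar.exists_chi_ball_package_cm_two_of_letters'` on `D_n = ball 0 (n+2)` — the co-discrete open `U`, the continued
vector `vX` and coordinates `cc : ℂ → ι′ → ℂ` (holomorphic on `U`), the data `α₁ =ᵐ zFun f_z^φ`, `col_j =ᵐ zFun f^{φ′_j}_{1−z}`, the equations `T_i vX(z) = ĥ_i(z)•vX(z)`,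
`cnst_N(ι vX(z)) = 1•α₁(z) + (Σ_j proj_j.smulRight col_j(z))(cc z)` and UNIQUENESS on `U`; (ii) the χʷ-BALL PACKAGE (datum `φ′_{j₀}`, dual family `(φ)`, the SAME ball ∕ weight
`n+3` ∕ level `a` ∕ convolution data `(h_i, T_i)`) — `U′, vX′, cc′ : ℂ → κ → ℂ, α₁′, col′`; (iii) the SWAP identities `α₁′(1 − z) = col_{j₀}(z)`, `col′_k(1 − z) = α₁(z)` in `𝓗_k(Z_a)`
(`Lp.ext` of (i)(ii)'s a.e. clauses: both sides `=ᵐ zFun f^{φ′_{j₀}}_{1−z}`, resp. `=ᵐ zFun f^{φ}_z`); (iv) the GLOBAL coefficient pieces of ★ X2_χ (`chiEisenstein_meromorphic_exports_core_of_packages`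
∕ K2E1-p14's CM head (A)): pole sets `P, P′` closed, co-discrete, `⊆ {Re ≤ 1}`; scalars `qc, qc′` analytic off them; and their agreement with the ball coordinates on the Godement part of
`U`, `U′` (`cc z j₀ = qc z`, `cc′ w default = qc′ w` for `1 < Re` — both are the Godement-range coefficient `bX`).  OUTPUT: **`∀ z, z ∉ P → 1 − z ∉ P′ → qc z · qc′ (1 − z) = 1`**.
PROOF.  §A the column FE on `U ∩ (1 − U′)` — ★ FILE 1 `coeff_mul_coeff_apply_eq_of_packages` (κ singleton, `u′ = Pi.single j₀ 1`) with `Cn := cnst_N ∘ ι`, `Q := 0`, `Lc z := Σ_j proj_j.smulRight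
col_j(z)` and the Hecke scalars `ĥ_i(z) = ∫ h_i·H^z` ((G1) ★ `sphericalTransform_symm_cm_two`): `cc′(1 − z)_default · cc(z)_{j₀} = 1`; §B identification `cc(z)_{j₀} = qc(z)` on `U ∖ P` and
`cc′(w)_default = qc′(w)` on `U′ ∖ P′` — ★ FILE 0 `eqOn_diff_of_eqOn_re_gt` (co-discrete holomorphy set, identity theorem, base point `3∕2 ∈ D_n`); §C a base point `z₀ ∈ U ∖ P` with
`1 − z₀ ∈ U′ ∖ P′` — ★ FILE 0 `exists_mem_and_sub_mem` at `½`; §D the identity `qc·qc′(1 − ·) = 1` near `z₀`, then everywhere off `P ∪ (1 − P′)` — ★ FILE 0 `mul_eq_one_of_eventually`.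
For a SELF-DUAL `χ` (`χʷ = χ`, ONE package serves both sides) this is the letter `hFE` of ★ `K2E1ChiUnitaryAxisContinuationCMTwo`.
HONEST LABEL: HC_CM is proved only modulo the 7 printed citations (2 remaining named inputs: hLiu418 = `stmt-HodgeConjecture-24832`, h413 = `stmt-HodgeConjecture-24833`) until rung 0
closes; this file asserts no named fact, closes no socket; count-neutral; hypothesis-first on the ★ package clauses (i)–(iv) (the letters of ★ §2c — convolution data, `hS1` — stay with
its caller).
[cite: BernsteinLapid2019, §4 Claims 2–5 (pp. 9–10) and §5] [cite: MoeglinWaldspurger1995, IV.1.8–IV.1.10] [cite: Langlands1976, §7]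

## References
* [BernsteinLapid2019] J. Bernstein, E. Lapid, *On the meromorphic continuation of Eisenstein series*, J. AMS 37 (2024), §4 Claims 2–5, §5.
* [MoeglinWaldspurger1995] C. Mœglin, J.-L. Waldspurger, *Spectral decomposition and Eisenstein series* (1995), IV.1.8–IV.1.10.
* [Langlands1976] R. P. Langlands, *On the Functional Equations Satisfied by Eisenstein Series*, LNM 544 (1976), §7.
-/

set_option autoImplicit false
set_option linter.dupNamespace false  -- the mandated namespace repeats the summit's segment (`HodgeConjecture.HodgeConjecture`)

noncomputable section

open MeasureTheory Filter Topology Set NumberField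
open scoped NNReal ENNReal
open Literature.NumberTheory.Automorphic Literature.NumberTheory.Automorphic.UnitaryGroup AdelicGroupData
open Summit.HodgeConjecture.HodgeConjecture.Cruxes.H413.K2E1BorelEisensteinU
open Summit.HodgeConjecture.HodgeConjecture.Cruxes.H413.K2E1BLBorelSpacesU2Defs
open Summit.HodgeConjecture.HodgeConjecture.Cruxes.H413.K2E1BLBorelOperatorsU2Defs
open Summit.HodgeConjecture.HodgeConjecture.Cruxes.H413.K2E1BLXSystemPackageFinDimU (sum_proj_smulRight_apply)
open Summit.HodgeConjecture.HodgeConjecture.Cruxes.H413.K2E1SphericalTransformSymmetryU (sphericalTransform_symm_cm_two)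
open Summit.HodgeConjecture.HodgeConjecture.Cruxes.H413.K2E1ScatteringFunctionalEquationOfUnique (eqOn_diff_of_eqOn_re_gt exists_mem_and_sub_mem mul_eq_one_of_eventually)
open Summit.HodgeConjecture.HodgeConjecture.Cruxes.H413.K2E1ConvexDiffCountableConnected (countable_of_codiscrete)
open Summit.HodgeConjecture.HodgeConjecture.Cruxes.H413.K2E1ChiScatteringFunctionalEquationCMTwo (coeff_mul_coeff_apply_eq_of_packages)

namespace Summit.HodgeConjecture.HodgeConjecture.Cruxes.H413.K2E1ChiScatteringFunctionalEquationCMTwoGlobal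

variable (L : Type) [Field L] [NumberField L] [IsCMField L]
  [MeasurableSpace (quasiSplit (↥(maximalRealSubfield L)) L (IsCMField.complexConj L) 2).Adelic] [BorelSpace (quasiSplit (↥(maximalRealSubfield L)) L (IsCMField.complexConj L) 2).Adelic]

/-- **C3 FILE 2 — THE GLOBAL FUNCTIONAL EQUATION `qc(z)·qc′(1 − z) = 1` OF THE RANK-ONE `(χ,τ)` SCATTERING SCALARS** (module docstring).  Binders: the common convolution data
(`h_i` left-`K_U`-invariant continuous compactly supported, the operators `T_i`), the ι-bound `hb`; (i) the χ-ball package clauses on `D_n` (`U`, `vX`, `cc : ℂ → ι′ → ℂ`, `α₁`, `col`,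
equations, uniqueness); (ii) the χʷ-ball package clauses (`U′`, `vX′`, `cc′ : ℂ → κ → ℂ`, `κ` a singleton, `α₁′`, `col′`); (iii) the swap identities; (iv) the global pieces `(P, qc)`, `(P′, qc′)`
with their Godement agreement with the ball coordinates.  THEN `∀ z, z ∉ P → 1 − z ∉ P′ → qc z * qc′ (1 − z) = 1`.
[cite: BernsteinLapid2019, §4 Claims 2–5 and §5] [cite: MoeglinWaldspurger1995, IV.1.8–IV.1.10] [cite: Langlands1976, §7] -/
theorem chi_scattering_fe_cm_two
    {μ : Measure (quasiSplit (↥(maximalRealSubfield L)) L (IsCMField.complexConj L) 2).automorphicQuotient}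
    (νG : Measure (quasiSplit (↥(maximalRealSubfield L)) L (IsCMField.complexConj L) 2).Adelic) [νG.IsHaarMeasure]
    {n : ℕ} {a : ℝ≥0} {μZ : Measure (borelQuotient (↥(maximalRealSubfield L)) L (IsCMField.complexConj L) 2)}
    (hb : IotaBound (↥(maximalRealSubfield L)) L (IsCMField.complexConj L) 2 (n + 3) a μ μZ)
    -- the common convolution data: left-`K_U`-invariant test functions `h_i ∈ C_c(G(𝔸))` and the operators `T_i`
    {I : Type} {h : I → (quasiSplit (↥(maximalRealSubfield L)) L (IsCMField.complexConj L) 2).Adelic → ℂ}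
    (hK : ∀ i, ∀ k₁ : (quasiSplit (↥(maximalRealSubfield L)) L (IsCMField.complexConj L) 2).Adelic,
      adelicVal (↥(maximalRealSubfield L)) L (IsCMField.complexConj L) 2 ((StdForm.antidiagonal 2).over L) k₁ ∈ standardMaximalCompactGL 2 L → ∀ x, h i (k₁ * x) = h i x)
    (hh : ∀ i, Continuous (h i)) (hhs : ∀ i, HasCompactSupport (h i))
    (T : I → HX (↥(maximalRealSubfield L)) L (IsCMField.complexConj L) 2 (n + 3) μ →L[ℂ] HX (↥(maximalRealSubfield L)) L (IsCMField.complexConj L) 2 (n + 3) μ)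
    -- (i) the χ-ball package on `D_n` (★ §2c's conclusion clauses): columns indexed by `ι′`, dual datum `j₀`
    {ι' : Type} [Fintype ι'] (j₀ : ι') {U : Set ℂ} (hUo : IsOpen U) (hUD : U ⊆ Metric.ball (0 : ℂ) (n + 2)) (hUcd : ∀ z₀ ∈ Metric.ball (0 : ℂ) (n + 2), ∀ᶠ s in 𝓝[≠] z₀, s ∈ U)
    {vX : ℂ → HX (↥(maximalRealSubfield L)) L (IsCMField.complexConj L) 2 (n + 3) μ} {cc : ℂ → ι' → ℂ} (hccd : DifferentiableOn ℂ cc U)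
    {α₁ : ℂ → HN (↥(maximalRealSubfield L)) L (IsCMField.complexConj L) 2 (n + 3) a μZ} {col : ι' → ℂ → HN (↥(maximalRealSubfield L)) L (IsCMField.complexConj L) 2 (n + 3) a μZ}
    (heqs : ∀ z ∈ U, (∀ i, T i (vX z) = (∫ x, h i x * (((borelHeight x : ℝ≥0) : ℝ) : ℂ) ^ z ∂νG) • vX z) ∧
      cnstN (↥(maximalRealSubfield L)) L (IsCMField.complexConj L) 2 (n + 3) a μZ (iota hb (vX z)) = (1 : ℂ) • α₁ z + (∑ j, (ContinuousLinearMap.proj (R := ℂ) (φ := fun _ : ι' => ℂ) j).smulRight (col j z) : (ι' → ℂ) →L[ℂ] HN (↥(maximalRealSubfield L)) L (IsCMField.complexConj L) 2 (n + 3) a μZ) (cc z))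
    (huniq : ∀ z ∈ U, ∀ (ψ : HX (↥(maximalRealSubfield L)) L (IsCMField.complexConj L) 2 (n + 3) μ) (b : ι' → ℂ), (∀ i, T i ψ = (∫ x, h i x * (((borelHeight x : ℝ≥0) : ℝ) : ℂ) ^ z ∂νG) • ψ) →
      cnstN (↥(maximalRealSubfield L)) L (IsCMField.complexConj L) 2 (n + 3) a μZ (iota hb ψ) = (1 : ℂ) • α₁ z + (∑ j, (ContinuousLinearMap.proj (R := ℂ) (φ := fun _ : ι' => ℂ) j).smulRight (col j z) : (ι' → ℂ) →L[ℂ] HN (↥(maximalRealSubfield L)) L (IsCMField.complexConj L) 2 (n + 3) a μZ) b →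
        ψ = vX z ∧ b = cc z)
    -- (ii) the χʷ-ball package on the same ball ∕ weight ∕ level (datum `φ′_{j₀}`; columns indexed by the singleton `κ` — the χ-line)
    {κ : Type} [Fintype κ] [Unique κ] {U' : Set ℂ} (hU'o : IsOpen U') (hU'D : U' ⊆ Metric.ball (0 : ℂ) (n + 2)) (hU'cd : ∀ z₀ ∈ Metric.ball (0 : ℂ) (n + 2), ∀ᶠ s in 𝓝[≠] z₀, s ∈ U')
    {vX' : ℂ → HX (↥(maximalRealSubfield L)) L (IsCMField.complexConj L) 2 (n + 3) μ} {cc' : ℂ → κ → ℂ} (hcc'd : DifferentiableOn ℂ cc' U')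
    {α₁' : ℂ → HN (↥(maximalRealSubfield L)) L (IsCMField.complexConj L) 2 (n + 3) a μZ} {col' : κ → ℂ → HN (↥(maximalRealSubfield L)) L (IsCMField.complexConj L) 2 (n + 3) a μZ}
    (heqs' : ∀ w ∈ U', (∀ i, T i (vX' w) = (∫ x, h i x * (((borelHeight x : ℝ≥0) : ℝ) : ℂ) ^ w ∂νG) • vX' w) ∧
      cnstN (↥(maximalRealSubfield L)) L (IsCMField.complexConj L) 2 (n + 3) a μZ (iota hb (vX' w)) = (1 : ℂ) • α₁' w + (∑ k, (ContinuousLinearMap.proj (R := ℂ) (φ := fun _ : κ => ℂ) k).smulRight (col' k w) : (κ → ℂ) →L[ℂ] HN (↥(maximalRealSubfield L)) L (IsCMField.complexConj L) 2 (n + 3) a μZ) (cc' w))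
    -- (iii) the swap identities in `𝓗_k(Z_a)` (`Lp.ext` of the packages' a.e. clauses)
    (hsw₁ : ∀ z ∈ U, 1 - z ∈ U' → α₁' (1 - z) = col j₀ z) (hsw₂ : ∀ z ∈ U, 1 - z ∈ U' → ∀ k, col' k (1 - z) = α₁ z)
    -- (iv) the global coefficient pieces (★ X2_χ clause shapes) and their Godement agreement with the ball coordinates
    {P P' : Set ℂ} {qc qc' : ℂ → ℂ}
    (hPc : IsClosed P) (hPcd : ∀ z₀ : ℂ, ∀ᶠ s in 𝓝[≠] z₀, s ∉ P) (hPre : ∀ z ∈ P, z.re ≤ 1) (hqa : ∀ z : ℂ, z ∉ P → AnalyticAt ℂ qc z)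
    (hP'c : IsClosed P') (hP'cd : ∀ z₀ : ℂ, ∀ᶠ s in 𝓝[≠] z₀, s ∉ P') (hP're : ∀ z ∈ P', z.re ≤ 1) (hq'a : ∀ z : ℂ, z ∉ P' → AnalyticAt ℂ qc' z)
    (hagree : ∀ z ∈ U, 1 < z.re → cc z j₀ = qc z) (hagree' : ∀ w ∈ U', 1 < w.re → cc' w default = qc' w) :
    ∀ z : ℂ, z ∉ P → 1 - z ∉ P' → qc z * qc' (1 - z) = 1 := by
  classical
  -- §A the column functional equation on `U ∩ (1 − U′)` (★ FILE 1, κ a singleton, `u′ = Pi.single j₀ 1`)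
  have hLu : ∀ z, (∑ j, (ContinuousLinearMap.proj (R := ℂ) (φ := fun _ : ι' => ℂ) j).smulRight (col j z) : (ι' → ℂ) →L[ℂ] HN (↥(maximalRealSubfield L)) L (IsCMField.complexConj L) 2 (n + 3) a μZ) (Pi.single j₀ (1 : ℂ)) = col j₀ z := fun z => by
    rw [sum_proj_smulRight_apply, Finset.sum_eq_single j₀ (fun j _ hj => by rw [Pi.single_eq_of_ne hj, zero_smul]) (fun hj => (hj (Finset.mem_univ j₀)).elim),
      Pi.single_eq_same, one_smul]
  have hFEloc : ∀ z ∈ U, 1 - z ∈ U' → cc' (1 - z) default * cc z j₀ = 1 := by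
    intro z hz hz'
    have key := coeff_mul_coeff_apply_eq_of_packages (κ := κ) 1 T (fun i z => ∫ x, h i x * (((borelHeight x : ℝ≥0) : ℝ) : ℂ) ^ z ∂νG)
      (fun i z => (sphericalTransform_symm_cm_two L νG (hK i) (hh i) (hhs i) z).symm)
      ((cnstN (↥(maximalRealSubfield L)) L (IsCMField.complexConj L) 2 (n + 3) a μZ).comp (iota hb))
      (0 : HX (↥(maximalRealSubfield L)) L (IsCMField.complexConj L) 2 (n + 3) μ →L[ℂ] HX (↥(maximalRealSubfield L)) L (IsCMField.complexConj L) 2 (n + 3) μ)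
      (fun _ : κ => α₁) (fun z => (∑ j, (ContinuousLinearMap.proj (R := ℂ) (φ := fun _ : ι' => ℂ) j).smulRight (col j z) : (ι' → ℂ) →L[ℂ] HN (↥(maximalRealSubfield L)) L (IsCMField.complexConj L) 2 (n + 3) a μZ))
      (fun _ : κ => vX) (fun _ : κ => cc)
      (fun _ z hz => ⟨(heqs z hz).1, by simpa only [ContinuousLinearMap.comp_apply] using (heqs z hz).2, rfl⟩)
      (fun z hz ψ b hT hC _ => huniq z hz ψ b hT (by simpa only [ContinuousLinearMap.comp_apply] using hC))
      α₁' (fun w => (∑ k, (ContinuousLinearMap.proj (R := ℂ) (φ := fun _ : κ => ℂ) k).smulRight (col' k w) : (κ → ℂ) →L[ℂ] HN (↥(maximalRealSubfield L)) L (IsCMField.complexConj L) 2 (n + 3) a μZ)) vX' cc'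
      (fun w hw => ⟨(heqs' w hw).1, by simpa only [ContinuousLinearMap.comp_apply] using (heqs' w hw).2, rfl⟩)
      (Pi.single j₀ (1 : ℂ)) (fun z hz hz' => by rw [hLu]; exact hsw₁ z hz hz')
      (fun z hz hz' b' => by rw [sum_proj_smulRight_apply]; exact Finset.sum_congr rfl fun k _ => by rw [hsw₂ z hz hz' k]) hz hz' j₀
    simpa only [Pi.single_eq_same] using key
  -- §B identification of the ball coordinates with the global pieces on `U ∖ P`, `U′ ∖ P′` (★ FILE 0 §2; base point `3∕2 ∈ D_n`)
  have h32 : (((3 / 2 : ℝ)) : ℂ) ∈ Metric.ball (0 : ℂ) (n + 2) := by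
    rw [mem_ball_zero_iff, Complex.norm_real, Real.norm_eq_abs, abs_of_pos (by norm_num : (0 : ℝ) < 3 / 2)]
    have h0 : (0 : ℝ) ≤ n := Nat.cast_nonneg n
    linarith
  have h32re : (1 : ℝ) < ((((3 / 2 : ℝ)) : ℂ)).re := by rw [Complex.ofReal_re]; norm_num
  have hid : ∀ z ∈ U, z ∉ P → cc z j₀ = qc z :=
    eqOn_diff_of_eqOn_re_gt (f := fun z => cc z j₀) hUo hUD hUcd (differentiableOn_pi.1 hccd j₀) hPc (countable_of_codiscrete hPcd) hPre (fun z _ hz => hqa z hz) h32 h32re hagree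
  have hid' : ∀ w ∈ U', w ∉ P' → cc' w default = qc' w :=
    eqOn_diff_of_eqOn_re_gt (f := fun w => cc' w default) hU'o hU'D hU'cd (differentiableOn_pi.1 hcc'd default) hP'c (countable_of_codiscrete hP'cd) hP're (fun z _ hz => hq'a z hz) h32 h32re hagree'
  -- §C a base point `z₀ ∈ U ∖ P` with `1 − z₀ ∈ U′ ∖ P′` (★ FILE 0 §3 at `½`)
  have hhalf : (((1 / 2 : ℝ)) : ℂ) ∈ Metric.ball (0 : ℂ) (n + 2) := by
    rw [mem_ball_zero_iff, Complex.norm_real, Real.norm_eq_abs, abs_of_pos (by norm_num : (0 : ℝ) < 1 / 2)]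
    have h0 : (0 : ℝ) ≤ n := Nat.cast_nonneg n
    linarith
  have hhalf' : (1 : ℂ) - (((1 / 2 : ℝ)) : ℂ) = (((1 / 2 : ℝ)) : ℂ) := by push_cast; ring
  obtain ⟨z₀, ⟨hz₀U, hz₀P⟩, h1z₀U, h1z₀P⟩ := exists_mem_and_sub_mem (U := U) (U' := U') (P := P) (P' := P') 1 ((((1 / 2 : ℝ)) : ℂ))
    (hUcd _ hhalf) (hPcd _) (by rw [hhalf']; exact hU'cd _ hhalf) (by rw [hhalf']; exact hP'cd _)
  -- §D the identity near `z₀`, then everywhere off `P ∪ (1 − P′)` (★ FILE 0 §3)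
  have hloc : ∀ᶠ z in 𝓝 z₀, qc z * qc' (1 - z) = 1 := by
    have hc1 : ContinuousAt (fun z : ℂ => 1 - z) z₀ := (continuous_const.sub continuous_id).continuousAt
    filter_upwards [hUo.mem_nhds hz₀U, hPc.isOpen_compl.mem_nhds hz₀P, hc1.eventually_mem (hU'o.mem_nhds h1z₀U),
      hc1.eventually_mem (hP'c.isOpen_compl.mem_nhds h1z₀P)] with z hzU hzP h1U h1P
    rw [← hid z hzU hzP, ← hid' (1 - z) h1U h1P, mul_comm]
    exact hFEloc z hzU h1U
  exact mul_eq_one_of_eventually 1 (countable_of_codiscrete hPcd) (countable_of_codiscrete hP'cd) hqa hq'a hloc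

end Summit.HodgeConjecture.HodgeConjecture.Cruxes.H413.K2E1ChiScatteringFunctionalEquationCMTwoGlobal

end
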